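import Mathlib
import HarnessLib
import Literature.Combinatorics.SimpleGraph.WallTopologicalMinor

/-!
# Route MonotoneRestoration, crux `MonotoneRestorationQP` (stmt-15886), line `linear_width` — the wall is connected

Helper file (`--supports stmt-ValiantsHypothesis-15886`), def-free: `wall_connected` (needed to make the parity-adaptive CFI
base `psubdiv (wall r) ℓ 1` connected, `PathSubdivision.psubdiv_connected`).  Honest label: plumbing; no stub closed.
[cite: GalesiEtAl2023, §2 (walls)]
-/

set_option linter.dupNamespace false

namespace Summit.ValiantsHypothesis.ValiantsHypothesis.Theorems.CFIOddCover

open Literature.Combinatorics.SimpleGraph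

/-- **The wall `W_r` is connected**: rows are paths, and consecutive rows `n, n+1` are joined by the vertical edge in column
`n % 2`. [cite: GalesiEtAl2023, §2 (walls)] -/
theorem wall_connected (r : ℕ) : (wall r).Connected := by
  -- along a row
  have hrow : ∀ (i : Fin (r + 1)) (n : ℕ) (hn : n < r + 1), (wall r).Reachable (i, 0) (i, ⟨n, hn⟩) := by
    intro i n
    induction n with
    | zero => intro hn; exact SimpleGraph.Reachable.refl _
    | succ n ih =>
      intro hn
      refine (ih (by omega)).trans (SimpleGraph.Adj.reachable ?_)
      rw [wall_adj]
      exact Or.inl ⟨rfl, Or.inl rfl⟩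
  have hrow' : ∀ (i j : Fin (r + 1)), (wall r).Reachable (i, 0) (i, j) := fun i j => hrow i j j.is_lt
  -- between consecutive rows
  have hcol : ∀ (n : ℕ) (hn : n + 1 < r + 1),
      (wall r).Reachable (⟨n, by omega⟩, 0) (⟨n + 1, hn⟩, 0) := by
    intro n hn
    have hj : n % 2 < r + 1 := by omega
    refine ((hrow ⟨n, by omega⟩ (n % 2) hj).trans (SimpleGraph.Adj.reachable ?_)).trans
      (hrow ⟨n + 1, hn⟩ (n % 2) hj).symm
    rw [wall_adj]
    refine Or.inr ⟨rfl, Or.inl ⟨rfl, ?_⟩⟩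
    simp only
    omega
  have hall : ∀ (n : ℕ) (hn : n < r + 1), (wall r).Reachable (0, 0) (⟨n, hn⟩, 0) := by
    intro n
    induction n with
    | zero => intro hn; exact SimpleGraph.Reachable.refl _
    | succ n ih => intro hn; exact (ih (by omega)).trans (hcol n hn)
  haveI : Nonempty (Fin (r + 1) × Fin (r + 1)) := ⟨(0, 0)⟩
  exact SimpleGraph.Connected.mk fun p q =>
    ((hall p.1 p.1.is_lt).trans (hrow' _ p.2)).symm.trans ((hall q.1 q.1.is_lt).trans (hrow' _ q.2))

end Summit.ValiantsHypothesis.ValiantsHypothesis.Theorems.CFIOddCover
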